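import Summits.MatrixMultiplication.OmegaCensus.STPPVosperSlackFourLawT
import Summits.MatrixMultiplication.OmegaCensus.STPPVosperSlackFourTablesZ61P1
import Summits.MatrixMultiplication.OmegaCensus.STPPVosperSlackFourTablesZ61P3
import Summits.MatrixMultiplication.OmegaCensus.STPPCell22Law
import Summits.MatrixMultiplication.OmegaCensus.STPPVosperTilingWordsPrunedQ
import Summits.MatrixMultiplication.OmegaCensus.STPPHamidouneRodsethInverseTheorem

/-!
# ω-census (abelian STPP census): the fifth leaf `{(2,2,2),(3,3,3),(3,3,3)} ⊄ ℤ₆₁` MODULO ITS KERNEL ROWS (assembly)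

HONEST FRAMING (pub-omega census; verbatim): lottery ticket; floor = certified bounds/negative ranges.
Census STRUCTURE (seat pub-omega-stpp-1 gen 33, 2026-08-29), family (b2).  `no_isSTPP_zmod61_222_333_333_of_rows`: the slack-4 law
`no_isSTPP_of_slack_four_tables_of_cell22` at block `i = 1` (a (3,3,3) block; others (3,3,3),(2,2,2); a = b = c = 3, L = z = 13, vol = 27,
13+3+27+3+13+2 = 61) with its cell (2,2) discharged by `cell22_false` (`STPPCell22Law.lean`); the remaining hypotheses are the kernel rows:
zoo root row, cells δ ≤ 1 (`rowsA0`, `rowsA1`, dead tables `tblZ61F5A0/A1` — SPEC #2), cell (2,2) stages 1/2/3.  The B-side rows coincide with the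
A-side rows (the leaf is symmetric under `A ↔ B`).  Checked sorry-free against the tree (scratch inlining, 03:48Z).  Successor: land (after `STPPCell22Law`), then discharge each hypothesis by the landed row theorem
(`zooNode_rroot`, `c22s1_all`, `plc22_real`, `tbl22G_sub`, `c22dead_all`, SPEC #2 assemblies) in `STPPVosperSlackFourKill222333333Z61.lean`.
Nothing here is progress on `ω`.
-/

open Finset
open scoped Pointwise

namespace Summit.MatrixMultiplication.OmegaCensus.CubeNB

open Literature.Computability.AlgebraicComplexity
open Literature.Combinatorics.Additive
open Summit.MatrixMultiplication.OmegaCensus.STPPKneser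
open Summit.MatrixMultiplication.OmegaCensus.CubeNB.S2
open Summit.MatrixMultiplication.OmegaCensus.CubeNB.Bits

/-- **Fifth leaf modulo rows**: `{(2,2,2),(3,3,3)²}` has no STPP realisation in `ℤ/61`, given the kernel rows as hypotheses.
[cite: CohnKleinbergSzegedyUmans2005, Def. 5.1] -/
theorem no_isSTPP_zmod61_222_333_333_of_rows
    (hrows : zooGo 61 zooTbl61 12 59 3 0 1 [0] = true)
    (rowsA0 : ∀ Q ∈ qShapes 61 3 0 ((61 - 1).choose (3 - 1)), dihedralSmaller 61 Q = true ∨ caseADeadT 61 3 3 13 13 Q tblZ61F5A0 = true)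
    (rowsA1 : ∀ h' ∈ List.range' 1 3, ∀ k ∈ List.range' 1 13, ∀ Q ∈ qShapes 61 3 0 ((61 - 1).choose (3 - 1)),
      dihedralSmaller 61 Q = true ∨ caseGDeadT 61 3 13 (3 + 13) ((List.range (3 + 1)).filter fun x => !(Nat.beq x h'))
        (((List.range (13 + 1)).filter fun x => !(Nat.beq x k)).map fun m => 3 + m) Q tblZ61F5A1 = true)
    (deadA0 : ∀ e ∈ tblZ61F5A0, existsCoverW 61 e.1 e.2 [blockDiffsWQ 61 e.1 e.2 3 3 3, blockDiffsWQ 61 e.1 e.2 2 2 2] [] [] [] = false)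
    (deadA1 : ∀ e ∈ tblZ61F5A1, existsCoverW 61 e.1 e.2 [blockDiffsWQ 61 e.1 e.2 3 3 3, blockDiffsWQ 61 e.1 e.2 2 2 2] [] [] [] = false)
    (hS1 : ∀ b ∈ zooShp61, ∀ w ∈ List.range' 1 60, place22Row 61 zooShp61 plc22 b w = true)
    (hS2 : (plc22.all (real22 61 zooNrm61 tbl22G)) = true)
    (hsub : (tbl22G.all fun g => g.2.all fun z => tbl22F.any fun e => Nat.beq e.1 g.1 && Nat.beq e.2 z) = true)
    (hdeadF : ∀ e ∈ tbl22F, existsCoverW 61 (members (List.range 61) e.1) (members (List.range 61) e.2)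
      [blockDiffsWQ 61 (members (List.range 61) e.1) (members (List.range 61) e.2) 3 3 3,
       blockDiffsWQ 61 (members (List.range 61) e.1) (members (List.range 61) e.2) 2 2 2] [] [] [] = false)
    (A B C : Fin 3 → Finset (ZMod 61)) (hS : IsSTPP A B C)
    (hA : ∀ i, #(A i) = ![2, 3, 3] i) (hB : ∀ i, #(B i) = ![2, 3, 3] i) (hC : ∀ i, #(C i) = ![2, 3, 3] i) : False := by
  haveI : Fact (Nat.Prime 61) := ⟨by norm_num⟩
  have hAne : ∀ i, (A i).Nonempty := fun i => card_pos.1 (by rw [hA]; fin_cases i <;> simp)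
  have hBne : ∀ i, (B i).Nonempty := fun i => card_pos.1 (by rw [hB]; fin_cases i <;> simp)
  have hCne : ∀ i, (C i).Nonempty := fun i => card_pos.1 (by rw [hC]; fin_cases i <;> simp)
  have e1 : (univ : Finset (Fin 3)).erase 1 = {0, 2} := by decide
  have hz : ∑ k ∈ (univ : Finset (Fin 3)).erase 1, #(A k) * #(C k) = 13 := by
    rw [e1, Finset.sum_pair (by decide)]; simp [hA, hC]
  have hL : ∑ k ∈ (univ : Finset (Fin 3)).erase 1, #(B k) * #(C k) = 13 := by
    rw [e1, Finset.sum_pair (by decide)]; simp [hB, hC]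
  have hszsA : ([2, 0] : List (Fin 3)).map (fun k => (#(A k), #(B k), #(C k))) = [(3, 3, 3), (2, 2, 2)] := by simp [hA, hB, hC]
  have hszsB : ([2, 0] : List (Fin 3)).map (fun k => (#(B k), #(A k), #(C k))) = [(3, 3, 3), (2, 2, 2)] := by simp [hA, hB, hC]
  have hdead0 : ∀ e ∈ tblZ61F5A0, CoverDead 61 3 1 [(3, 3, 3), (2, 2, 2)] e.1 e.2 :=
    coverDead_forall_of_rows (blockEnumSound_blockDiffsWQ 61) fun e he => deadA0 e he
  have hdead1 : ∀ e ∈ tblZ61F5A1, CoverDead 61 3 1 [(3, 3, 3), (2, 2, 2)] e.1 e.2 :=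
    coverDead_forall_of_rows (blockEnumSound_blockDiffsWQ 61) fun e he => deadA1 e he
  have hdeadF' : ∀ e ∈ tbl22F, CoverDead 61 3 1 [(3, 3, 3), (2, 2, 2)] (members (List.range 61) e.1) (members (List.range 61) e.2) :=
    fun e he => coverDead_of_existsCoverW (blockEnumSound_blockDiffsWQ 61) (by simpa using hdeadF e he)
  exact no_isSTPP_of_slack_four_tables_of_cell22 hamidouneRodsethInverseTheorem_holds hS hAne hBne hCne 1 ⟨0, by decide⟩
    (a := 3) (b := 3) (c := 3) (L := 13) (z := 13) (vol := 27) (tblA0 := tblZ61F5A0) (tblB0 := tblZ61F5A0) (tblA1 := tblZ61F5A1) (tblB1 := tblZ61F5A1)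
    (by rw [hA]; rfl) (by rw [hB]; rfl) (by rw [hC]; rfl) hz hL rfl (by norm_num)
    (by norm_num) (by norm_num) (by norm_num) (by norm_num) (by norm_num) (by norm_num)
    [2, 0] (by decide) (fun k => by fin_cases k <;> decide) hszsA hszsB hdead0 hdead0 hdead1 hdead1
    rowsA0 rowsA0 rowsA1 rowsA1
    (fun hSY hT => cell22_false hrows hS hAne hBne hCne 1 (by rw [hA]; rfl) (by rw [hB]; rfl) (by rw [hC]; rfl) hz hL [2, 0] (by decide)
      (fun k => by fin_cases k <;> decide) hszsA hS1 hS2 hsub hdeadF' hSY hT)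

end Summit.MatrixMultiplication.OmegaCensus.CubeNB
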